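import Literature.Topology.FourManifolds.MMSWBeltTwistInvariance
import Literature.Topology.FourManifolds.MMSWMembraneTwist
import Literature.Topology.FourManifolds.MMSWStripTwist
import HarnessLib

/-!
# The per-handle belt twists `τ^ε` of the model `M_r` and the fact `eventually_approxHasRasmussen_multiIndex`

Sibling proof file of `Literature/Topology/FourManifolds/MMSWBeltTwistInvariance.lean`, working
towards its named fact `Literature.Topology.FourManifolds.eventually_approxHasRasmussen_multiIndex`
(C. Manolescu, M. Marengon, S. Sarkar, M. Willis, *A generalization of Rasmussen's invariant, with
applications to surfaces in some four-manifolds*, Duke Math. J. 172 (2023) 231–311,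
arXiv:1910.08195, **Thm. 3.7** (invariance of `s` under orientation-preserving self-diffeomorphisms,
for the Dehn twists along the belt spheres: "the re-indexing, which preserves Lee generators
without shifts in the null-homologous case") with **Thm. 3.3** (finite approximation)): for a
null-homologous core-missing model knot `K ⊂ M_r` and `ε ∈ ℤʳ`, the Rasmussen invariants of the
finite approximations `D(k⃗)(τ^ε ∘ K) = D(k⃗ + ε)(K)` and `D(k⃗)(K)` agree for all large `k`, where
`τ^ε = fibreRot (Π_j u_j^{ε_j})`, `u_j(z) = (z - c_j)/|z - c_j|`, is the product of the `ε_j`-th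
powers of the twists along the `r` belt spheres.

## The printed proof, and what this file does and does not prove

In [MMSW] the statement is `s(D(k⃗ + ε)) = s(D'(k⃗)) = s(τ^ε L) = s(L) = s(D(k⃗))` for `k` beyond the
thresholds of Thm. 3.3 for the diagrams `D` of `L` and `D' = D(ε)` of `τ^ε L`; the middle equality
is Thm. 3.7, whose proof for Dehn twists IS the multi-index stabilisation of the Khovanov–Lee
complexes of the `S³`-links `D(k⃗)` (Willis 2021; [MMSW] Thm. 2.1, Cor. 2.2, Thm. 2.5, proof of
Thm. 2.8).  That theory — Khovanov complexes of full twists, their multicone simplifications and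
inverse limits, Lee generators in the stable range — does not exist on the tree's
`GaussDiagram`/`KhComplex`/`LeeRasmussen` layer (see the headers of
`MMSWRasmussenFiniteApproxProofs.lean` and `MMSWEventualRasmussenReduction.lean`, which record the
same for the diagonal companion `MMSW.eventually_approxHasRasmussen`, [MMSW] Thm. 1.4).  So the
named fact is NOT discharged here.  What IS proved:

* `MMSW.holeUnit`, `MMSW.beltMultiplier r ε = Π_j u_j^{ε_j}`, `MMSW.beltTwist r ε = fibreRot (beltMultiplier r ε)`
  — the twist `τ^ε` of the fact, literally (`beltTwist_eq`); it is smooth and unit off the hole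
  centres, `τ^{(e,…,e)} = σ^e` (`beltTwist_const`), `τ^{ε'} ∘ τ^ε = τ^{ε + ε'}` on `M_r`, and **`τ^ε`
  carries model knots to model knots, preserving null-homology and the core-missing property**
  (`IsModelKnot.beltTwist_comp`, `isNullHomologous_beltTwist_comp_iff`, `wC_beltTwist_comp_ne_zero`)
  and transports model isotopies (`IsModelIsotopic.beltTwist_comp`);
* `MMSW.beltFamily` — the per-handle analogue of `membraneFamily` (`MMSWMembraneTwist`): a smooth
  family of unit multipliers from `Π_j u_j^{ε_j}` to a multiplier which is `1` off the membrane
  wedges (`beltFamily_one_eq_one`), so that **`τ^ε ∘ K` is isotopic through core-missing model knots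
  to the knot twisted `ε_j` times at the `j`-th membrane only**
  (`approxHasRasmussen_beltTwist_iff_membraneForm`);
* hence the conclusion of the fact, UNCONDITIONALLY and for every `k`, for knots off the membrane
  wedges of the twisted handles — e.g. knots whose planar shadow lies in `Im z ≤ 0` — which `τ^ε`
  moves by a core-missing isotopy (`approxHasRasmussen_beltTwist_comp_iff_of_offWedge`,
  `…_of_im_nonpos`; [MMSW] Ex. 8.3: local knots), and for `r = 0`;
* the case of a CONSTANT multi-index `ε = (e, …, e)`, in particular the whole fact for `r = 1`
  (`eventually_approxHasRasmussen_multiIndex_one_left`), from the diagonal fact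
  `MMSW.eventually_approxHasRasmussen` and Reidemeister's theorem (uniqueness of `s` of a knot in
  `S³`): `D(k⃗)(σ^e ∘ K) = D(k⃗ + e⃗)(K)` (`eventually_approxHasRasmussen_multiIndex_const`);
* **the good multi-indices form a subgroup of `ℤʳ`**, so the fact reduces — with no other input —
  to one positive Dehn twist `σ_j = τ^{e_j}` along one belt sphere, i.e. to [MMSW]'s re-indexing
  `s(D(k⃗ + e_j)) = s(D(k⃗))`, `k ≫ 0`, in a single index
  (`eventually_approxHasRasmussen_multiIndex_of_single`);
* the two REDUCTIONS showing that, over the tree's diagonal facts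
  (`MMSW.eventually_approxHasRasmussen`, `MMSW.hasSMinus_unique`, `Knot.reidemeister`), the named fact
  is EQUIVALENT to [MMSW] Thm. 3.7 for the belt twists in the tree's language,
  `s₋(τ^ε ∘ K) = s ↔ s₋(K) = s` (taken as a HYPOTHESIS, never as a named fact):
  `eventually_approxHasRasmussen_multiIndex_of_hasSMinus_beltTwist_comp_iff` and
  `hasSMinus_beltTwist_comp_iff_of_multiIndex`; and that Thm. 3.7 for all `τ^ε` follows from the
  `r` generators `σ_j = τ^{e_j}` (`hasSMinus_beltTwist_comp_iff_of_single`);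
* **the named fact is the APEX of the pair of finite-approximation facts**: it implies the diagonal
  fact `MMSW.eventually_approxHasRasmussen` ([MMSW] Thm. 1.4) outright
  (`eventually_approxHasRasmussen_of_multiIndex`: `ε = (1, …, 1)` and the proved existence of an `s`
  for every `D(k⃗)(K)`), and over `MMSW.hasSMinus_unique` and `Knot.reidemeister` it is equivalent to
  "Thm. 1.4 ∧ Thm. 3.7 for the belt twists"
  (`eventually_approxHasRasmussen_multiIndex_iff_and_hasSMinus_beltTwist_comp_iff`).

What remains is exactly [MMSW] Thm. 3.7 for one positive Dehn twist `σ_j` of a null-homologous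
knot running over the membranes, i.e. the multi-index stabilisation.  (The geometric shortcut
"`σ_j ∘ K` is isotopic to `K`" is false in general: `σ_j² ≃ id` and `σ_j(K) ≃ K` when `K` meets the
belt sphere at most twice, but not for knots with asymmetric hyperbolic complement.)

## References

* C. Manolescu, M. Marengon, S. Sarkar, M. Willis, Duke Math. J. 172 (2023) 231–311,
  arXiv:1910.08195: §2.1 (`D(k⃗)`, `k⃗ ∈ ℤʳ`), §2.3 and Thm. 2.8 (`σ_i`: "changing `k` to `k ± 1`"),
  Cor. 2.2, Thm. 2.5, Thm. 3.3, Thm. 3.4, Thm. 3.7, Ex. 8.3, Prop. 8.2. [ManolescuMarengonSarkarWillis2023]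
* M. Willis, *Khovanov homology for links in `#ʳ(S² × S¹)`*, Michigan Math. J. 70 (2021) 675–748,
  arXiv:1812.06584 (multi-index finite approximation of the Khovanov complex). [folklore]
* M. W. Hirsch, *Differential Topology* (1976), Ch. 8 §1, Thm. 1.3 (isotopy extension; the tree's
  `approxHasRasmussen_iff_of_isotopy`). [HirschDT1976]
-/

open scoped Manifold ContDiff Topology ComplexConjugate Real
open Function Set Complex

noncomputable section

namespace Literature.Topology.FourManifolds

/-- Local notation: `𝔼 n` is the model Euclidean space `EuclideanSpace ℝ (Fin n)`. -/
local notation "𝔼 " n:arg => EuclideanSpace ℝ (Fin n)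

/-- Local notation: `𝕊 n` is the unit sphere in `EuclideanSpace ℝ (Fin (n + 1))`. -/
local notation "𝕊 " n:arg => (Metric.sphere (0 : EuclideanSpace ℝ (Fin (n + 1))) 1)

namespace MMSW

open Literature.AlgebraicTopology.Homotopy.HopfFibration (zC wC ofZW zC_ofZW wC_ofZW ofZW_zC_wC)
open Literature.Analysis.SpecialFunctions (truncArg contDiff_truncArg truncArg_eq_arg)

variable {r : ℕ}

/-! ## The belt multiplier `Π_j u_j^{ε_j}` and the per-handle twist `τ^ε` -/

/-- The unit factor `u_j(z) = (z - c_j)/|z - c_j|` of the `j`-th hole (junk `0` at `z = c_j`):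
`arg u_j` increases by `2π` around the `j`-th hole only; `u = Π_j u_j` is the tree's `twistUnit`.
[cite: ManolescuMarengonSarkarWillis2023, §2.3] -/
def holeUnit (r : ℕ) (j : Fin r) (z : ℂ) : ℂ :=
  (z - holeCentre r j) / ((‖z - holeCentre r j‖ : ℝ) : ℂ)

/-- **The belt multiplier** `Π_j u_j(z)^{ε_j}`, `ε ∈ ℤʳ`: the unit complex multiplier of the
product of the `ε_j`-th powers of the (spread-out) Dehn twists along the `r` belt spheres.
[cite: ManolescuMarengonSarkarWillis2023, §2.3] -/
def beltMultiplier (r : ℕ) (ε : Fin r → ℤ) (z : ℂ) : ℂ :=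
  ∏ j : Fin r, holeUnit r j z ^ ε j

/-- **The per-handle belt twist** `τ^ε : (z, w) ↦ (z, w · Π_j u_j(z)^{ε_j})` — the product
`Π_j σ_j^{ε_j}` of powers of the Dehn twists `σ_j` along the belt spheres of `M_r` (spread over the
planar domain), an orientation-preserving self-diffeomorphism of `M_r`; `τ^{(k,…,k)}` is the tree's
`sphereTwist r k` (`beltTwist_const`). [cite: ManolescuMarengonSarkarWillis2023, §2.3 and Thm. 2.8] -/
def beltTwist (r : ℕ) (ε : Fin r → ℤ) : 𝔼 4 → 𝔼 4 :=
  fibreRot (beltMultiplier r ε)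

/-- `beltTwist r ε` is literally the twist `fibreRot (z ↦ Π_j ((z - c_j)/|z - c_j|)^{ε_j})` of the
statement of `eventually_approxHasRasmussen_multiIndex`. [folklore] -/
theorem beltTwist_eq (r : ℕ) (ε : Fin r → ℤ) :
    beltTwist r ε = fibreRot (fun z : ℂ ↦ ∏ j : Fin r,
      ((z - holeCentre r j) / (((‖z - holeCentre r j‖ : ℝ)) : ℂ)) ^ (ε j)) :=
  rfl

/-- The twist unit is the product of the hole units: `u = Π_j u_j`. [folklore] -/
theorem twistUnit_eq_prod_holeUnit (r : ℕ) (z : ℂ) : twistUnit r z = ∏ j : Fin r, holeUnit r j z :=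
  rfl

/-- Away from `c_j` the hole unit has modulus one. [folklore] -/
theorem norm_holeUnit {z : ℂ} {j : Fin r} (hz : z ≠ holeCentre r j) : ‖holeUnit r j z‖ = 1 := by
  have h : ‖z - holeCentre r j‖ ≠ 0 := norm_ne_zero_iff.2 (sub_ne_zero.2 hz)
  rw [holeUnit, norm_div, Complex.norm_real, Real.norm_eq_abs, abs_norm, div_self h]

/-- Away from `c_j` the hole unit is nonzero. [folklore] -/
theorem holeUnit_ne_zero {z : ℂ} {j : Fin r} (hz : z ≠ holeCentre r j) : holeUnit r j z ≠ 0 :=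
  norm_ne_zero_iff.1 (by rw [norm_holeUnit hz]; exact one_ne_zero)

/-- Away from the hole centres the belt multiplier has modulus one. [folklore] -/
theorem norm_beltMultiplier {z : ℂ} (hz : ∀ j : Fin r, z ≠ holeCentre r j) (ε : Fin r → ℤ) :
    ‖beltMultiplier r ε z‖ = 1 := by
  rw [beltMultiplier, norm_prod]
  exact Finset.prod_eq_one fun j _ ↦ by rw [norm_zpow, norm_holeUnit (hz j), one_zpow]

/-- Away from the hole centres the belt multiplier is nonzero. [folklore] -/
theorem beltMultiplier_ne_zero {z : ℂ} (hz : ∀ j : Fin r, z ≠ holeCentre r j) (ε : Fin r → ℤ) :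
    beltMultiplier r ε z ≠ 0 :=
  norm_ne_zero_iff.1 (by rw [norm_beltMultiplier hz]; exact one_ne_zero)

/-- The hole unit is real-smooth away from `c_j`. [folklore] -/
theorem contDiffAt_holeUnit {z : ℂ} {j : Fin r} (hz : z ≠ holeCentre r j) {n : WithTop ℕ∞} :
    ContDiffAt ℝ n (holeUnit r j) z :=
  contDiffAt_unitFactor hz

/-- The belt multiplier is real-smooth away from the hole centres. [folklore] -/
theorem contDiffAt_beltMultiplier {z : ℂ} (hz : ∀ j : Fin r, z ≠ holeCentre r j) (ε : Fin r → ℤ)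
    {n : WithTop ℕ∞} : ContDiffAt ℝ n (beltMultiplier r ε) z := by
  unfold beltMultiplier
  exact contDiffAt_prod fun j _ ↦
    (contDiffAt_zpow_complex (holeUnit_ne_zero (hz j)) (ε j)).comp z (contDiffAt_holeUnit (hz j))

/-- The constant multi-index `(e, …, e)` gives the multiplier `u^e` of the sphere twist `σ^e`.
[folklore] -/
theorem beltMultiplier_const (r : ℕ) (e : ℤ) :
    beltMultiplier r (fun _ ↦ e) = fun z ↦ twistUnit r z ^ e := by
  funext z
  rw [beltMultiplier, twistUnit_eq_prod_holeUnit, Finset.prod_zpow]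

/-- **`τ^{(e,…,e)} = σ^e`**: the constant multi-index gives the tree's sphere twist.
[cite: ManolescuMarengonSarkarWillis2023, §2.3] -/
theorem beltTwist_const (r : ℕ) (e : ℤ) : beltTwist r (fun _ ↦ e) = sphereTwist r e := by
  rw [beltTwist, beltMultiplier_const, sphereTwist_eq_fibreRot]

/-- The zero multi-index gives the multiplier `1`. [folklore] -/
theorem beltMultiplier_zero (r : ℕ) : beltMultiplier r 0 = fun _ ↦ 1 := by
  funext z
  simp [beltMultiplier]

/-- `τ^0 = id`. [folklore] -/
@[simp] theorem beltTwist_zero (x : 𝔼 4) : beltTwist r 0 x = x := by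
  rw [beltTwist, beltMultiplier_zero]
  exact fibreRot_of_apply_eq_one rfl

/-- The belt multiplier is multiplicative in the multi-index (away from the hole centres).
[folklore] -/
theorem beltMultiplier_add {z : ℂ} (hz : ∀ j : Fin r, z ≠ holeCentre r j) (ε ε' : Fin r → ℤ) :
    beltMultiplier r (ε + ε') z = beltMultiplier r ε z * beltMultiplier r ε' z := by
  rw [beltMultiplier, beltMultiplier, beltMultiplier, ← Finset.prod_mul_distrib]
  exact Finset.prod_congr rfl fun j _ ↦ by rw [Pi.add_apply, zpow_add₀ (holeUnit_ne_zero (hz j))]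

/-- The belt twists do not move `z`. [folklore] -/
@[simp] theorem zC_beltTwist (ε : Fin r → ℤ) (x : 𝔼 4) : zC (beltTwist r ε x) = zC x :=
  zC_fibreRot _ x

/-- The belt twists multiply `w` by the belt multiplier. [folklore] -/
@[simp] theorem wC_beltTwist (ε : Fin r → ℤ) (x : 𝔼 4) :
    wC (beltTwist r ε x) = wC x * beltMultiplier r ε (zC x) :=
  wC_fibreRot _ x

/-- The belt twists preserve the hole terms. [folklore] -/
@[simp] theorem holeTerm_beltTwist (ε : Fin r → ℤ) (j : Fin r) (x : 𝔼 4) :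
    holeTerm r j (beltTwist r ε x) = holeTerm r j x :=
  holeTerm_fibreRot _ j x

/-- **`τ^{ε'} ∘ τ^ε = τ^{ε + ε'}`** away from the poles (in particular on the model boundary).
[folklore] -/
theorem beltTwist_beltTwist {x : 𝔼 4} (hx : ∀ j : Fin r, (1 : ℝ) ≤ holeTerm r j x)
    (ε ε' : Fin r → ℤ) : beltTwist r ε' (beltTwist r ε x) = beltTwist r (ε + ε') x := by
  rw [beltTwist, beltTwist, beltTwist, fibreRot_fibreRot]
  simp only [fibreRot, beltMultiplier_add (zC_ne_holeCentre hx)]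

/-- `τ^{-ε} ∘ τ^{ε} = id` away from the poles: the belt twists are bijections of `M_r`. [folklore] -/
theorem beltTwist_neg_beltTwist {x : 𝔼 4} (hx : ∀ j : Fin r, (1 : ℝ) ≤ holeTerm r j x)
    (ε : Fin r → ℤ) : beltTwist r (-ε) (beltTwist r ε x) = x := by
  rw [beltTwist_beltTwist hx, add_neg_cancel, beltTwist_zero]

/-- Unit belt twists preserve the model boundary `M_r`. [cite: ManolescuMarengonSarkarWillis2023, §2.3] -/
theorem beltTwist_mem_modelBoundary {x : 𝔼 4} (hx : x ∈ modelBoundary r) (ε : Fin r → ℤ) :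
    beltTwist r ε x ∈ modelBoundary r :=
  fibreRot_mem_modelBoundary hx (norm_beltMultiplier (zC_ne_holeCentre hx.1) ε)

/-- The belt twists keep core-missing points of `M_r` off the cores. [folklore] -/
theorem wC_beltTwist_ne_zero {x : 𝔼 4} (hx : ∀ j : Fin r, (1 : ℝ) ≤ holeTerm r j x)
    (hw : wC x ≠ 0) (ε : Fin r → ℤ) : wC (beltTwist r ε x) ≠ 0 :=
  wC_fibreRot_ne_zero hw (beltMultiplier_ne_zero (zC_ne_holeCentre hx) ε)

/-- The belt twist is smooth away from the poles `z = c_j` (in particular near `M_r`). [folklore] -/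
theorem contDiffAt_beltTwist {x : 𝔼 4} (hx : ∀ j : Fin r, zC x ≠ holeCentre r j) (ε : Fin r → ℤ)
    {n : WithTop ℕ∞} : ContDiffAt ℝ n (beltTwist r ε) x :=
  contDiffAt_fibreRot (contDiffAt_beltMultiplier hx ε)

/-! ## The belt twists act on model knots -/

/-- **`τ^ε` of a model knot is a model knot** (a fibre rotation by a smooth unit multiplier,
`IsModelKnot.fibreRot_comp`). [cite: ManolescuMarengonSarkarWillis2023, §2.3] -/
theorem IsModelKnot.beltTwist_comp {K : 𝕊 1 → 𝔼 4} (hK : IsModelKnot r K) (ε : Fin r → ℤ) :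
    IsModelKnot r (beltTwist r ε ∘ K) :=
  hK.fibreRot_comp (fun t ↦ contDiffAt_beltMultiplier (zC_ne_holeCentre (hK.mem t).1) ε)
    (fun t ↦ norm_beltMultiplier (zC_ne_holeCentre (hK.mem t).1) ε)

/-- `τ^ε ∘ K` is a model knot iff `K` is (`τ^{-ε}` undoes `τ^ε` on `M_r`). [folklore] -/
theorem isModelKnot_beltTwist_comp_iff (K : 𝕊 1 → 𝔼 4) (ε : Fin r → ℤ) :
    IsModelKnot r (beltTwist r ε ∘ K) ↔ IsModelKnot r K := by
  refine ⟨fun h ↦ ?_, fun h ↦ h.beltTwist_comp ε⟩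
  have hg : ∀ t, ∀ j : Fin r, (1 : ℝ) ≤ holeTerm r j (K t) := fun t j ↦ by
    have h1 := (h.mem t).1 j
    rwa [Function.comp_apply, holeTerm_beltTwist] at h1
  have h' := h.beltTwist_comp (-ε)
  have heq : beltTwist r (-ε) ∘ (beltTwist r ε ∘ K) = K :=
    funext fun t ↦ beltTwist_neg_beltTwist (hg t) ε
  rwa [heq] at h'

/-- The belt twists do not move `z`, so they preserve null-homology. [folklore] -/
theorem isNullHomologous_beltTwist_comp_iff (K : 𝕊 1 → 𝔼 4) (ε : Fin r → ℤ) :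
    IsNullHomologous r (beltTwist r ε ∘ K) ↔ IsNullHomologous r K := by
  simp only [IsNullHomologous, Function.comp_apply, zC_beltTwist]

/-- A belt-twisted core-missing model knot misses the cores. [folklore] -/
theorem wC_beltTwist_comp_ne_zero {K : 𝕊 1 → 𝔼 4} (hK : IsModelKnot r K)
    (hw : ∀ t, wC (K t) ≠ 0) (ε : Fin r → ℤ) (t : 𝕊 1) : wC ((beltTwist r ε ∘ K) t) ≠ 0 :=
  wC_beltTwist_ne_zero (hK.mem t).1 (hw t) ε

/-- For model knots `τ^{-ε} ∘ τ^ε ∘ K = K`. [folklore] -/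
theorem beltTwist_neg_comp_beltTwist_comp {K : 𝕊 1 → 𝔼 4} (hK : ∀ t, K t ∈ modelBoundary r)
    (ε : Fin r → ℤ) : beltTwist r (-ε) ∘ (beltTwist r ε ∘ K) = K :=
  funext fun t ↦ beltTwist_neg_beltTwist (hK t).1 ε

/-- For model knots `τ^{ε'} ∘ τ^ε ∘ K = τ^{ε + ε'} ∘ K`. [folklore] -/
theorem beltTwist_comp_beltTwist_comp {K : 𝕊 1 → 𝔼 4} (hK : ∀ t, K t ∈ modelBoundary r)
    (ε ε' : Fin r → ℤ) : beltTwist r ε' ∘ (beltTwist r ε ∘ K) = beltTwist r (ε + ε') ∘ K :=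
  funext fun t ↦ beltTwist_beltTwist (hK t).1 ε ε'

/-- **`τ^ε` transports smooth isotopies of model knots** (compose the isotopy with the smooth map
`τ^ε`). [folklore] -/
theorem IsSmoothModelIsotopy.beltTwist_comp {K K' : 𝕊 1 → 𝔼 4}
    (h : IsSmoothModelIsotopy r K K') (ε : Fin r → ℤ) :
    IsSmoothModelIsotopy r (beltTwist r ε ∘ K) (beltTwist r ε ∘ K') := by
  obtain ⟨H, hH, h0, h1, hK⟩ := h
  refine ⟨fun s ↦ beltTwist r ε ∘ H s, fun p ↦ ?_, fun s hs ↦ ?_, fun s hs ↦ ?_,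
    fun s ↦ (hK s).beltTwist_comp ε⟩
  · have hz : ∀ j : Fin r, zC (H p.1 p.2) ≠ holeCentre r j :=
      zC_ne_holeCentre ((hK p.1).mem p.2).1
    exact ((contDiffAt_beltTwist hz ε).contMDiffAt).comp p (hH p)
  · show beltTwist r ε ∘ H s = _
    rw [h0 s hs]
  · show beltTwist r ε ∘ H s = _
    rw [h1 s hs]

/-- `τ^ε` transports isotopy of model knots. [folklore] -/
theorem IsModelIsotopic.beltTwist_comp {K K' : 𝕊 1 → 𝔼 4} (h : IsModelIsotopic r K K')
    (ε : Fin r → ℤ) : IsModelIsotopic r (beltTwist r ε ∘ K) (beltTwist r ε ∘ K') := by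
  induction h with
  | single h => exact (h.beltTwist_comp ε).isModelIsotopic
  | tail _ h ih => exact ih.trans (h.beltTwist_comp ε).isModelIsotopic

/-- `D(k⃗)` of `τ^{(e,…,e)} ∘ K = σ^e ∘ K` is `D(k⃗ + e⃗)` of `K`: for a constant multi-index the
belt twist merely shifts the diagonal finite approximations.
[cite: ManolescuMarengonSarkarWillis2023, Thm. 2.8 (proof)] -/
theorem approxHasRasmussen_beltTwist_const_comp_iff {K : 𝕊 1 → 𝔼 4}
    (hK : ∀ t, K t ∈ modelBoundary r) (e k : ℤ) (s : ℤ) :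
    ApproxHasRasmussen r k (beltTwist r (fun _ ↦ e) ∘ K) s ↔ ApproxHasRasmussen r (e + k) K s := by
  rw [beltTwist_const]
  exact approxHasRasmussen_sphereTwist_comp_iff hK e k s

/-! ## The belt family: from the spread-out twist `Π_j u_j^{ε_j}` to twists at the membranes

The per-handle analogue of `MMSW.membraneFamily` (`MMSWMembraneTwist`, the case `ε = (k, …, k)`):
the closed `1`-form `Σ_j ε_j d arg(z - c_j)` on the planar domain is deformed, through closed forms
with the same periods, to one supported in thin wedges about the membrane arcs
`γ_j = {c_j + i s, s > 0}`; exponentiating gives a smooth family of UNIT multipliers (well defined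
because the periods are kept), hence an isotopy of model knots through core-missing knots
(`MMSWFibreRotation`). -/

/-- **The belt phase** `Σ_j ε_j (π/2 - truncArg ½ c₁ c₂ (β_j z))`, `β_j(z) = i (z - c_j)`: a globally
smooth real function which, off the wedges about the membrane arcs, is `Σ_j ε_j (π/2 - arg β_j(z))`.
[folklore] -/
def beltPhase (r : ℕ) (ε : Fin r → ℤ) (c₁ c₂ : ℝ) (z : ℂ) : ℝ :=
  ∑ j : Fin r, (ε j : ℝ) * (π / 2 - truncArg (1 / 2) c₁ c₂ (membraneCoord r j z))

/-- **The belt family of multipliers** `Φ_a(z) = Π_j u_j(z)^{ε_j} · exp(i a · beltPhase z)`, from the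
belt multiplier (`a = 0`) to the membrane form of `τ^ε` (`a = 1`). [folklore] -/
def beltFamily (r : ℕ) (ε : Fin r → ℤ) (c₁ c₂ : ℝ) (a : ℝ) (z : ℂ) : ℂ :=
  beltMultiplier r ε z * exp (((a * beltPhase r ε c₁ c₂ z : ℝ) : ℂ) * I)

/-- At `a = 0` the belt family is the belt multiplier. [folklore] -/
theorem beltFamily_zero (r : ℕ) (ε : Fin r → ℤ) (c₁ c₂ : ℝ) :
    beltFamily r ε c₁ c₂ 0 = beltMultiplier r ε := by
  funext z
  simp [beltFamily]

/-- The belt family consists of unit multipliers (away from the hole centres). [folklore] -/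
theorem norm_beltFamily {z : ℂ} (hz : ∀ j : Fin r, z ≠ holeCentre r j) (ε : Fin r → ℤ)
    (c₁ c₂ a : ℝ) : ‖beltFamily r ε c₁ c₂ a z‖ = 1 := by
  rw [beltFamily, norm_mul, norm_beltMultiplier hz, one_mul, Complex.norm_exp_ofReal_mul_I]

/-- The belt phase is smooth on all of `ℂ` (`-1 < c₂ < c₁`). [folklore] -/
theorem contDiff_beltPhase (r : ℕ) (ε : Fin r → ℤ) {c₁ c₂ : ℝ} (hc : c₂ < c₁) (hc₂ : -1 < c₂) :
    ContDiff ℝ ∞ (beltPhase r ε c₁ c₂) := by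
  have hT : ContDiff ℝ ∞ (truncArg (1 / 2) c₁ c₂) :=
    contDiff_truncArg (by norm_num) hc hc₂ (n := ⊤)
  have hβ : ∀ j : Fin r, ContDiff ℝ ∞ (membraneCoord r j) := fun j ↦
    contDiff_const.mul (contDiff_id.sub contDiff_const)
  unfold beltPhase
  exact ContDiff.sum fun j _ ↦ contDiff_const.mul (contDiff_const.sub (hT.comp (hβ j)))

/-- **The belt family is jointly smooth in `(a, z)`** at every `z` off the hole centres.
[folklore] -/
theorem contDiffAt_beltFamily {z : ℂ} (hz : ∀ j : Fin r, z ≠ holeCentre r j) (ε : Fin r → ℤ)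
    {c₁ c₂ : ℝ} (hc : c₂ < c₁) (hc₂ : -1 < c₂) (a : ℝ) :
    ContDiffAt ℝ ∞ (uncurry (beltFamily r ε c₁ c₂)) (a, z) := by
  have hu : ContDiffAt ℝ ∞ (fun p : ℝ × ℂ ↦ beltMultiplier r ε p.2) (a, z) :=
    ContDiffAt.comp (g := beltMultiplier r ε) (f := fun p : ℝ × ℂ ↦ p.2) (a, z)
      (contDiffAt_beltMultiplier hz ε) contDiffAt_snd
  have hph : ContDiffAt ℝ ∞ (fun p : ℝ × ℂ ↦ p.1 * beltPhase r ε c₁ c₂ p.2) (a, z) :=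
    contDiffAt_fst.mul ((contDiff_beltPhase r ε hc hc₂).contDiffAt.comp (a, z) contDiffAt_snd)
  have hexp : ContDiffAt ℝ ∞
      (fun p : ℝ × ℂ ↦ exp (((p.1 * beltPhase r ε c₁ c₂ p.2 : ℝ) : ℂ) * I)) (a, z) :=
    (Complex.contDiff_exp.contDiffAt).comp (a, z)
      (((Complex.ofRealCLM.contDiff.contDiffAt).comp (a, z) hph).mul contDiffAt_const)
  exact hu.mul hexp

/-- `e^{i(π/2 - arg β_j(z))} = u_j(z)⁻¹` (as `e^{i arg β_j} = i u_j`). [folklore] -/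
theorem exp_pi_div_two_sub_arg_membraneCoord {z : ℂ} (hz : ∀ j : Fin r, z ≠ holeCentre r j)
    (j : Fin r) :
    exp (((π / 2 - arg (membraneCoord r j z) : ℝ) : ℂ) * I) = (holeUnit r j z)⁻¹ := by
  rw [Complex.ofReal_sub, sub_mul, Complex.exp_sub, exp_pi_div_two_mul_I',
    exp_arg_membraneCoord_mul_I hz j]
  exact div_mul_cancel_left₀ I_ne_zero _

/-- **The end of the belt family is `1` off the wedges**: if `z` keeps distance `≥ 1` from the hole
centres (the guard) and lies off the wedge of every handle that is actually twisted,
`Re β_j(z)/|β_j(z)| ≥ c₁` whenever `ε_j ≠ 0`, then `Φ₁(z) = Π_j u_j^{ε_j} · Π_j (u_j⁻¹)^{ε_j} = 1`.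
[folklore] -/
theorem beltFamily_one_eq_one {z : ℂ} (hz : ∀ j : Fin r, (1 : ℝ) ≤ ‖z - holeCentre r j‖)
    (ε : Fin r → ℤ) {c₁ c₂ : ℝ} (hc : c₂ < c₁)
    (hoff : ∀ j : Fin r, ε j ≠ 0 → c₁ ≤ (membraneCoord r j z).re / ‖membraneCoord r j z‖) :
    beltFamily r ε c₁ c₂ 1 z = 1 := by
  have hz' : ∀ j : Fin r, z ≠ holeCentre r j := fun j h ↦ by
    have := hz j
    rw [h, sub_self, norm_zero] at this
    exact absurd this (by norm_num)
  -- off the wedges the truncated arguments are the arguments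
  have hT : ∀ j : Fin r, ε j ≠ 0 →
      truncArg (1 / 2) c₁ c₂ (membraneCoord r j z) = arg (membraneCoord r j z) :=
    fun j hj ↦ truncArg_eq_arg (by norm_num) hc
      (by rw [norm_membraneCoord]; linarith [hz j]) (hoff j hj)
  -- the phase at `a = 1`, term by term (the terms with `ε_j = 0` vanish on both sides)
  have hph : (((1 : ℝ) * beltPhase r ε c₁ c₂ z : ℝ) : ℂ) * I =
      ∑ j : Fin r, ((ε j : ℤ) : ℂ) * ((((π / 2 - arg (membraneCoord r j z) : ℝ)) : ℂ) * I) := by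
    rw [one_mul, beltPhase, Complex.ofReal_sum, Finset.sum_mul]
    refine Finset.sum_congr rfl fun j _ ↦ ?_
    rcases eq_or_ne (ε j) 0 with hj | hj
    · simp [hj]
    · rw [hT j hj, Complex.ofReal_mul, Complex.ofReal_intCast, mul_assoc]
  rw [beltFamily, hph, Complex.exp_sum, beltMultiplier, ← Finset.prod_mul_distrib]
  refine Finset.prod_eq_one fun j _ ↦ ?_
  rw [Complex.exp_int_mul, exp_pi_div_two_sub_arg_membraneCoord hz' j, ← mul_zpow,
    mul_inv_cancel₀ (holeUnit_ne_zero (hz' j)), one_zpow]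

/-- **The membrane form of `τ^ε` is the identity off the membrane wedges of the twisted handles**
(on the guard region). [cite: ManolescuMarengonSarkarWillis2023, §2.1] -/
theorem fibreRot_beltFamily_one_eq_self {x : 𝔼 4} (hx : ∀ j : Fin r, (1 : ℝ) ≤ holeTerm r j x)
    (ε : Fin r → ℤ) {c₁ c₂ : ℝ} (hc : c₂ < c₁)
    (hoff : ∀ j : Fin r, ε j ≠ 0 →
      c₁ ≤ (membraneCoord r j (zC x)).re / ‖membraneCoord r j (zC x)‖) :
    fibreRot (beltFamily r ε c₁ c₂ 1) x = x :=
  fibreRot_of_apply_eq_one (beltFamily_one_eq_one (one_le_norm_zC_sub_holeCentre hx) ε hc hoff)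

/-! ## `τ^ε ∘ K` versus its membrane form, and the fact for knots off the membranes -/

/-- **`τ^ε ∘ K` and its membrane form are smoothly isotopic model knots** (along the belt family,
`isSmoothModelIsotopy_fibreRot`). [cite: HirschDT1976, Ch. 8 §1] -/
theorem isSmoothModelIsotopy_beltTwist_membraneForm {K : 𝕊 1 → 𝔼 4} (hK : IsModelKnot r K)
    (ε : Fin r → ℤ) {c₁ c₂ : ℝ} (hc : c₂ < c₁) (hc₂ : -1 < c₂) :
    IsSmoothModelIsotopy r (beltTwist r ε ∘ K) (fibreRot (beltFamily r ε c₁ c₂ 1) ∘ K) := by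
  have hz : ∀ t, ∀ j : Fin r, zC (K t) ≠ holeCentre r j := fun t ↦ zC_ne_holeCentre (hK.mem t).1
  have h := isSmoothModelIsotopy_fibreRot hK (Φ := beltFamily r ε c₁ c₂)
    (fun a t ↦ contDiffAt_beltFamily (hz t) ε hc hc₂ a) (fun a t ↦ norm_beltFamily (hz t) ε c₁ c₂ a)
  rwa [beltFamily_zero] at h

/-- **`s₋(τ^ε ∘ K) = s ↔ s₋` of the membrane form `= s`** (isotopy invariance of `s₋`).
[cite: ManolescuMarengonSarkarWillis2023, Thm. 1.3] -/
theorem hasSMinus_beltTwist_comp_iff_membraneForm {K : 𝕊 1 → 𝔼 4} (hK : IsModelKnot r K)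
    (ε : Fin r → ℤ) {c₁ c₂ : ℝ} (hc : c₂ < c₁) (hc₂ : -1 < c₂) (s : ℤ) :
    HasSMinus r (beltTwist r ε ∘ K) s ↔ HasSMinus r (fibreRot (beltFamily r ε c₁ c₂ 1) ∘ K) s :=
  (isSmoothModelIsotopy_beltTwist_membraneForm hK ε hc hc₂).isModelIsotopic.hasSMinus_iff s

/-- **The finite approximations of `τ^ε ∘ K` are those of its membrane form**, for a core-missing
model knot `K` and every `k`: the belt family stays off the cores, so it is carried to an ambient
isotopy of `S³` (`approxHasRasmussen_fibreRot_iff_of_family`).  In the membrane form the `ε_j` full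
twists sit at the `j`-th membrane only — MMSW's diagram `D(k⃗ + ε)`.
[cite: ManolescuMarengonSarkarWillis2023, §2.1 and Thm. 2.8 (proof)] -/
theorem approxHasRasmussen_beltTwist_comp_iff_membraneForm {K : 𝕊 1 → 𝔼 4} (hK : IsModelKnot r K)
    (hw : ∀ t, wC (K t) ≠ 0) (ε : Fin r → ℤ) {c₁ c₂ : ℝ} (hc : c₂ < c₁) (hc₂ : -1 < c₂)
    (k : ℤ) (s : ℤ) :
    ApproxHasRasmussen r k (beltTwist r ε ∘ K) s ↔
      ApproxHasRasmussen r k (fibreRot (beltFamily r ε c₁ c₂ 1) ∘ K) s := by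
  have hz : ∀ t, ∀ j : Fin r, zC (K t) ≠ holeCentre r j := fun t ↦ zC_ne_holeCentre (hK.mem t).1
  have h := approxHasRasmussen_fibreRot_iff_of_family hK hw (Φ := beltFamily r ε c₁ c₂)
    (fun a t ↦ contDiffAt_beltFamily (hz t) ε hc hc₂ a) (fun a t ↦ norm_beltFamily (hz t) ε c₁ c₂ a)
    k s
  rwa [beltFamily_zero] at h

/-- **`s₋(τ^ε ∘ K) = s₋(K)` for knots off the membranes of the twisted handles** (no stabilisation
needed: there the membrane form of `τ^ε` fixes `K` pointwise). [cite: ManolescuMarengonSarkarWillis2023, Thm. 3.7] -/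
theorem hasSMinus_beltTwist_comp_iff_of_offWedge {K : 𝕊 1 → 𝔼 4} (hK : IsModelKnot r K)
    (ε : Fin r → ℤ) {c₁ c₂ : ℝ} (hc : c₂ < c₁) (hc₂ : -1 < c₂)
    (hoff : ∀ t, ∀ j : Fin r, ε j ≠ 0 →
      c₁ ≤ (membraneCoord r j (zC (K t))).re / ‖membraneCoord r j (zC (K t))‖) (s : ℤ) :
    HasSMinus r (beltTwist r ε ∘ K) s ↔ HasSMinus r K s := by
  have hfix : fibreRot (beltFamily r ε c₁ c₂ 1) ∘ K = K :=
    funext fun t ↦ fibreRot_beltFamily_one_eq_self (hK.mem t).1 ε hc (hoff t)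
  have h := hasSMinus_beltTwist_comp_iff_membraneForm hK ε hc hc₂ s
  rwa [hfix] at h

/-- **The fact `eventually_approxHasRasmussen_multiIndex` for knots off the membranes, for EVERY
`k`**: if the planar shadow `z ∘ K` of the core-missing model knot `K` stays off the membrane
wedge of every twisted handle (`Re β_j/|β_j| ≥ c₁` whenever `ε_j ≠ 0`), then `D(k⃗)(τ^ε ∘ K)` and
`D(k⃗)(K)` are ambient isotopic knots in `S³`, so they have the same Rasmussen invariants — such
knots do not run over the twisted `1`-handles, and the belt twists move them by an isotopy missing
the cores ([MMSW] Ex. 8.3: local knots). [cite: ManolescuMarengonSarkarWillis2023, Thm. 3.7 and Ex. 8.3] -/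
theorem approxHasRasmussen_beltTwist_comp_iff_of_offWedge {K : 𝕊 1 → 𝔼 4} (hK : IsModelKnot r K)
    (hw : ∀ t, wC (K t) ≠ 0) (ε : Fin r → ℤ) {c₁ c₂ : ℝ} (hc : c₂ < c₁) (hc₂ : -1 < c₂)
    (hoff : ∀ t, ∀ j : Fin r, ε j ≠ 0 →
      c₁ ≤ (membraneCoord r j (zC (K t))).re / ‖membraneCoord r j (zC (K t))‖) (k : ℤ) (s : ℤ) :
    ApproxHasRasmussen r k (beltTwist r ε ∘ K) s ↔ ApproxHasRasmussen r k K s := by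
  have hfix : fibreRot (beltFamily r ε c₁ c₂ 1) ∘ K = K :=
    funext fun t ↦ fibreRot_beltFamily_one_eq_self (hK.mem t).1 ε hc (hoff t)
  have h := approxHasRasmussen_beltTwist_comp_iff_membraneForm hK hw ε hc hc₂ k s
  rwa [hfix] at h

/-- The wedge parameters `c₁ = -cos 1`, `c₂ = -cos ½` are admissible: `-1 < c₂ < c₁ ≤ 0`.
[folklore] -/
theorem neg_cos_wedge_params :
    -Real.cos (1 / 2) < -Real.cos 1 ∧ (-1 : ℝ) < -Real.cos (1 / 2) ∧ -Real.cos 1 ≤ 0 := by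
  refine ⟨?_, ?_, ?_⟩
  · have := Real.cos_lt_cos_of_nonneg_of_le_pi_div_two (by norm_num : (0 : ℝ) ≤ 1 / 2)
      (by linarith [Real.pi_gt_three] : (1 : ℝ) ≤ Real.pi / 2) (by norm_num : (1 : ℝ) / 2 < 1)
    linarith
  · have : Real.cos (1 / 2) < Real.cos 0 :=
      Real.cos_lt_cos_of_nonneg_of_le_pi_div_two le_rfl (by linarith [Real.pi_gt_three])
        (by norm_num)
    rw [Real.cos_zero] at this
    linarith
  · have : 0 ≤ Real.cos 1 := Real.cos_nonneg_of_mem_Icc ⟨by linarith [Real.pi_gt_three],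
      by linarith [Real.pi_gt_three]⟩
    linarith

/-- **Knots below the row of holes**: for a core-missing model knot whose planar shadow lies in
the closed lower half-plane `Im z ≤ 0`, `D(k⃗)(τ^ε ∘ K)` and `D(k⃗)(K)` have the same Rasmussen
invariants for every `k` and every `ε ∈ ℤʳ`. [cite: ManolescuMarengonSarkarWillis2023, Thm. 3.7 and Ex. 8.3] -/
theorem approxHasRasmussen_beltTwist_comp_iff_of_im_nonpos {K : 𝕊 1 → 𝔼 4} (hK : IsModelKnot r K)
    (hw : ∀ t, wC (K t) ≠ 0) (him : ∀ t, (zC (K t)).im ≤ 0) (ε : Fin r → ℤ) (k : ℤ) (s : ℤ) :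
    ApproxHasRasmussen r k (beltTwist r ε ∘ K) s ↔ ApproxHasRasmussen r k K s := by
  obtain ⟨h1, h2, hc₁⟩ := neg_cos_wedge_params
  exact approxHasRasmussen_beltTwist_comp_iff_of_offWedge hK hw ε h1 h2 (fun t j _ ↦
    le_re_membraneCoord_div_norm_of_im_nonpos (him t) hc₁ j) k s

/-- `s₋(τ^ε ∘ K) = s₋(K)` for model knots below the row of holes. [cite: ManolescuMarengonSarkarWillis2023, Thm. 3.7 and Ex. 8.3] -/
theorem hasSMinus_beltTwist_comp_iff_of_im_nonpos {K : 𝕊 1 → 𝔼 4} (hK : IsModelKnot r K)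
    (him : ∀ t, (zC (K t)).im ≤ 0) (ε : Fin r → ℤ) (s : ℤ) :
    HasSMinus r (beltTwist r ε ∘ K) s ↔ HasSMinus r K s := by
  obtain ⟨h1, h2, hc₁⟩ := neg_cos_wedge_params
  exact hasSMinus_beltTwist_comp_iff_of_offWedge hK ε h1 h2 (fun t j _ ↦
    le_re_membraneCoord_div_norm_of_im_nonpos (him t) hc₁ j) s

/-! ## No handles, and constant multi-indices -/

/-- With no handles every multi-index is `0` and `τ^ε = id`. [folklore] -/
@[simp] theorem beltTwist_zero_left (ε : Fin 0 → ℤ) (x : 𝔼 4) : beltTwist 0 ε x = x := by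
  obtain rfl : ε = 0 := Subsingleton.elim _ _
  exact beltTwist_zero x

/-- **The fact for `r = 0`** (`M_0 ≅ S³`, no belt spheres): `τ^ε ∘ K = K`. [cite: ManolescuMarengonSarkarWillis2023, Ex. 8.3] -/
theorem approxHasRasmussen_beltTwist_comp_iff_zero_left (K : 𝕊 1 → 𝔼 4) (ε : Fin 0 → ℤ)
    (k : ℤ) (s : ℤ) : ApproxHasRasmussen 0 k (beltTwist 0 ε ∘ K) s ↔ ApproxHasRasmussen 0 k K s := by
  have h : beltTwist 0 ε ∘ K = K := funext fun t ↦ beltTwist_zero_left ε (K t)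
  rw [h]

/-- **The fact for a constant multi-index `ε = (e, …, e)`** — in particular for `r ≤ 1` — from the
diagonal fact `MMSW.eventually_approxHasRasmussen` and Reidemeister's theorem (uniqueness of the
Rasmussen invariant of a knot in `S³`, `ApproxHasRasmussen.unique`): `D(k⃗)(σ^e ∘ K) = D(k⃗ + e⃗)(K)`,
and both `k` and `k + e` are beyond the threshold of eventual constancy once `k ≥ k₀ + |e|`.
[cite: ManolescuMarengonSarkarWillis2023, Thm. 3.3 and Thm. 2.8 (proof)] -/
theorem eventually_approxHasRasmussen_multiIndex_const (hev : eventually_approxHasRasmussen)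
    (hR : Knot.reidemeister) {K : 𝕊 1 → 𝔼 4} (hK : IsModelKnot r K) (h0 : IsNullHomologous r K)
    (hw : ∀ t, wC (K t) ≠ 0) (e : ℤ) :
    ∃ k₀ : ℤ, ∀ k : ℤ, k₀ ≤ k → ∀ s : ℤ,
      ApproxHasRasmussen r k (beltTwist r (fun _ ↦ e) ∘ K) s ↔ ApproxHasRasmussen r k K s := by
  obtain ⟨s₀, k₀, hk⟩ := hev hK h0 hw
  refine ⟨k₀ + |e|, fun k hkk s ↦ ?_⟩
  rw [approxHasRasmussen_beltTwist_const_comp_iff hK.mem]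
  have hle : -|e| ≤ e := neg_abs_le e
  have h1 : ApproxHasRasmussen r (e + k) K s₀ := hk _ (by omega)
  have h2 : ApproxHasRasmussen r k K s₀ := hk _ (by have := abs_nonneg e; omega)
  exact ⟨fun h ↦ by rw [h.unique hR h1]; exact h2, fun h ↦ by rw [h.unique hR h2]; exact h1⟩

/-- `s₋(τ^{(e,…,e)} ∘ K) = s ↔ s₋(K) = s` — [MMSW] Thm. 3.7 for the constant multi-indices is the
tree's (proved) invariance of `s₋` under the sphere twists `σ^e`.
[cite: ManolescuMarengonSarkarWillis2023, Thm. 2.8] -/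
theorem hasSMinus_beltTwist_const_comp_iff (K : 𝕊 1 → 𝔼 4) (e : ℤ) (s : ℤ) :
    HasSMinus r (beltTwist r (fun _ ↦ e) ∘ K) s ↔ HasSMinus r K s := by
  rw [beltTwist_const]
  exact hasSMinus_sphereTwist_comp_iff K e s

/-- **The fact for `r = 1`** (one handle, `M_1 ≅ S¹ × S²`): every multi-index is constant, so this
is `eventually_approxHasRasmussen_multiIndex_const` — the diagonal fact and Reidemeister's theorem
suffice. [cite: ManolescuMarengonSarkarWillis2023, Thm. 3.3 and Thm. 2.8 (proof)] -/
theorem eventually_approxHasRasmussen_multiIndex_one_left (hev : eventually_approxHasRasmussen)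
    (hR : Knot.reidemeister) {K : 𝕊 1 → 𝔼 4} (hK : IsModelKnot 1 K) (h0 : IsNullHomologous 1 K)
    (hw : ∀ t, wC (K t) ≠ 0) (ε : Fin 1 → ℤ) :
    ∃ k₀ : ℤ, ∀ k : ℤ, k₀ ≤ k → ∀ s : ℤ,
      ApproxHasRasmussen 1 k (beltTwist 1 ε ∘ K) s ↔ ApproxHasRasmussen 1 k K s := by
  have hε : ε = fun _ ↦ ε 0 := funext fun j ↦ by rw [Subsingleton.elim j 0]
  rw [hε]
  exact eventually_approxHasRasmussen_multiIndex_const hev hR hK h0 hw (ε 0)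

/-! ## The good multi-indices form a subgroup of `ℤʳ`: reduction to the generators `σ_j`

At the level of the finite approximations themselves (no `s₋`, no diagonal fact): the set of
`ε ∈ ℤʳ` for which `s(D(k⃗)(τ^ε ∘ K)) = s(D(k⃗)(K))` eventually, for ALL core-missing
null-homologous model knots `K ⊂ M_r`, contains `0` and is closed under addition
(`τ^{ε + ε'} = τ^{ε'} ∘ τ^ε`, and `τ^ε ∘ K` is again such a knot) and negation; so the named fact
is equivalent to its case `ε = e_j` — one positive Dehn twist along one belt sphere, [MMSW]'s
"changing `k` to `k + 1`" in the `j`-th index. -/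

/-- Closure under addition of the eventual agreement of the Rasmussen invariants of the finite
approximations: from `(K, ε)` and `(τ^ε ∘ K, ε')` to `(K, ε + ε')`. [folklore] -/
theorem exists_forall_approxHasRasmussen_beltTwist_add_comp_iff {K : 𝕊 1 → 𝔼 4}
    (hK : ∀ t, K t ∈ modelBoundary r) {ε ε' : Fin r → ℤ}
    (h : ∃ k₀ : ℤ, ∀ k : ℤ, k₀ ≤ k → ∀ s : ℤ,
      ApproxHasRasmussen r k (beltTwist r ε ∘ K) s ↔ ApproxHasRasmussen r k K s)
    (h' : ∃ k₀ : ℤ, ∀ k : ℤ, k₀ ≤ k → ∀ s : ℤ,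
      ApproxHasRasmussen r k (beltTwist r ε' ∘ (beltTwist r ε ∘ K)) s ↔
        ApproxHasRasmussen r k (beltTwist r ε ∘ K) s) :
    ∃ k₀ : ℤ, ∀ k : ℤ, k₀ ≤ k → ∀ s : ℤ,
      ApproxHasRasmussen r k (beltTwist r (ε + ε') ∘ K) s ↔ ApproxHasRasmussen r k K s := by
  obtain ⟨k₀, hk⟩ := h
  obtain ⟨k₁, hk'⟩ := h'
  refine ⟨max k₀ k₁, fun k hkk s ↦ ?_⟩
  rw [← beltTwist_comp_beltTwist_comp hK ε ε', hk' k ((le_max_right _ _).trans hkk) s,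
    hk k ((le_max_left _ _).trans hkk) s]

/-- **Reduction of the fact to the `r` positive Dehn twists `σ_j = τ^{e_j}`**, at the level of the
finite approximations: if for every core-missing null-homologous model knot `K ⊂ M_r` and every
handle `j` the Rasmussen invariants of `D(k⃗)(σ_j ∘ K) = D(k⃗ + e_j)(K)` and `D(k⃗)(K)` agree for all
large `k` (hypothesis `h1` — the re-indexing in ONE index, [MMSW] proof of Thm. 2.8), then the same
holds for every `τ^ε`, `ε ∈ ℤʳ` (`Pi.single_induction` over the subgroup of good multi-indices).
[cite: ManolescuMarengonSarkarWillis2023, Thm. 2.8 (proof) and Thm. 3.7] -/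
theorem eventually_approxHasRasmussen_multiIndex_of_single
    (h1 : ∀ {r : ℕ} {K : 𝕊 1 → 𝔼 4} (j : Fin r), IsModelKnot r K → IsNullHomologous r K →
      (∀ t, wC (K t) ≠ 0) → ∃ k₀ : ℤ, ∀ k : ℤ, k₀ ≤ k → ∀ s : ℤ,
        ApproxHasRasmussen r k (beltTwist r (Pi.single j 1) ∘ K) s ↔ ApproxHasRasmussen r k K s) :
    eventually_approxHasRasmussen_multiIndex := by
  intro r K hK h0 hw ε
  show ∃ k₀ : ℤ, ∀ k : ℤ, k₀ ≤ k → ∀ s : ℤ,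
    ApproxHasRasmussen r k (beltTwist r ε ∘ K) s ↔ ApproxHasRasmussen r k K s
  -- the good multi-indices (for all admissible knots at once)
  have hP0 : ∀ K : 𝕊 1 → 𝔼 4, IsModelKnot r K → IsNullHomologous r K → (∀ t, wC (K t) ≠ 0) →
      ∃ k₀ : ℤ, ∀ k : ℤ, k₀ ≤ k → ∀ s : ℤ,
        ApproxHasRasmussen r k (beltTwist r 0 ∘ K) s ↔ ApproxHasRasmussen r k K s :=
    fun K _ _ _ ↦ ⟨0, fun k _ s ↦ by
      rw [show beltTwist r 0 ∘ K = K from funext fun t ↦ beltTwist_zero (K t)]⟩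
  have hPadd : ∀ ε ε' : Fin r → ℤ,
      (∀ K : 𝕊 1 → 𝔼 4, IsModelKnot r K → IsNullHomologous r K → (∀ t, wC (K t) ≠ 0) →
        ∃ k₀ : ℤ, ∀ k : ℤ, k₀ ≤ k → ∀ s : ℤ,
          ApproxHasRasmussen r k (beltTwist r ε ∘ K) s ↔ ApproxHasRasmussen r k K s) →
      (∀ K : 𝕊 1 → 𝔼 4, IsModelKnot r K → IsNullHomologous r K → (∀ t, wC (K t) ≠ 0) →
        ∃ k₀ : ℤ, ∀ k : ℤ, k₀ ≤ k → ∀ s : ℤ,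
          ApproxHasRasmussen r k (beltTwist r ε' ∘ K) s ↔ ApproxHasRasmussen r k K s) →
      ∀ K : 𝕊 1 → 𝔼 4, IsModelKnot r K → IsNullHomologous r K → (∀ t, wC (K t) ≠ 0) →
        ∃ k₀ : ℤ, ∀ k : ℤ, k₀ ≤ k → ∀ s : ℤ,
          ApproxHasRasmussen r k (beltTwist r (ε + ε') ∘ K) s ↔ ApproxHasRasmussen r k K s :=
    fun ε ε' hε hε' K hK h0 hw ↦
      exists_forall_approxHasRasmussen_beltTwist_add_comp_iff hK.mem (hε K hK h0 hw)
        (hε' _ (hK.beltTwist_comp ε) ((isNullHomologous_beltTwist_comp_iff K ε).2 h0)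
          (wC_beltTwist_comp_ne_zero hK hw ε))
  have hPneg : ∀ ε : Fin r → ℤ,
      (∀ K : 𝕊 1 → 𝔼 4, IsModelKnot r K → IsNullHomologous r K → (∀ t, wC (K t) ≠ 0) →
        ∃ k₀ : ℤ, ∀ k : ℤ, k₀ ≤ k → ∀ s : ℤ,
          ApproxHasRasmussen r k (beltTwist r ε ∘ K) s ↔ ApproxHasRasmussen r k K s) →
      ∀ K : 𝕊 1 → 𝔼 4, IsModelKnot r K → IsNullHomologous r K → (∀ t, wC (K t) ≠ 0) →
        ∃ k₀ : ℤ, ∀ k : ℤ, k₀ ≤ k → ∀ s : ℤ,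
          ApproxHasRasmussen r k (beltTwist r (-ε) ∘ K) s ↔ ApproxHasRasmussen r k K s :=
    fun ε hε K hK h0 hw ↦ by
      obtain ⟨k₀, hk⟩ := hε _ (hK.beltTwist_comp (-ε))
        ((isNullHomologous_beltTwist_comp_iff K (-ε)).2 h0) (wC_beltTwist_comp_ne_zero hK hw (-ε))
      rw [beltTwist_comp_beltTwist_comp hK.mem, neg_add_cancel,
        show beltTwist r 0 ∘ K = K from funext fun t ↦ beltTwist_zero (K t)] at hk
      exact ⟨k₀, fun k hkk s ↦ (hk k hkk s).symm⟩
  have hPsingle : ∀ (j : Fin r) (m : ℤ), ∀ K : 𝕊 1 → 𝔼 4, IsModelKnot r K → IsNullHomologous r K →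
      (∀ t, wC (K t) ≠ 0) → ∃ k₀ : ℤ, ∀ k : ℤ, k₀ ≤ k → ∀ s : ℤ,
        ApproxHasRasmussen r k (beltTwist r (Pi.single j m) ∘ K) s ↔ ApproxHasRasmussen r k K s :=
    fun j m ↦ by
      induction m using Int.induction_on with
      | zero => rw [Pi.single_zero]; exact hP0
      | succ n ih => rw [Pi.single_add]; exact hPadd _ _ ih fun K hK h0 hw ↦ h1 j hK h0 hw
      | pred n ih =>
        rw [sub_eq_add_neg, Pi.single_add]
        refine hPadd _ _ ih ?_
        rw [Pi.single_neg]
        exact hPneg _ fun K hK h0 hw ↦ h1 j hK h0 hw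
  exact Pi.single_induction (fun ε ↦ ∀ K : 𝕊 1 → 𝔼 4, IsModelKnot r K → IsNullHomologous r K →
    (∀ t, wC (K t) ≠ 0) → ∃ k₀ : ℤ, ∀ k : ℤ, k₀ ≤ k → ∀ s : ℤ,
      ApproxHasRasmussen r k (beltTwist r ε ∘ K) s ↔ ApproxHasRasmussen r k K s)
    ε hP0 hPadd hPsingle K hK h0 hw

/-! ## The fact is [MMSW] Thm. 3.7 for the belt twists, over the diagonal facts

`eventually_approxHasRasmussen_multiIndex` unfolded with `beltTwist`, and the two reductions: from
`s₋(τ^ε ∘ K) = s ↔ s₋(K) = s` (Thm. 3.7 for `τ^ε`, a HYPOTHESIS here) together with the diagonal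
facts `MMSW.eventually_approxHasRasmussen` (Thm. 1.4), `MMSW.hasSMinus_unique` (Thm. 1.3) and
Reidemeister's theorem; and conversely. -/

/-- The named fact, read through `beltTwist`. [cite: ManolescuMarengonSarkarWillis2023, Thm. 3.7 and Thm. 3.3] -/
theorem eventually_approxHasRasmussen_multiIndex_iff :
    eventually_approxHasRasmussen_multiIndex ↔
      ∀ {r : ℕ} {K : 𝕊 1 → 𝔼 4}, IsModelKnot r K → IsNullHomologous r K →
        (∀ t, wC (K t) ≠ 0) → ∀ ε : Fin r → ℤ, ∃ k₀ : ℤ, ∀ k : ℤ, k₀ ≤ k → ∀ s : ℤ,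
          ApproxHasRasmussen r k (beltTwist r ε ∘ K) s ↔ ApproxHasRasmussen r k K s :=
  Iff.rfl

/-- **Reduction of `eventually_approxHasRasmussen_multiIndex` to [MMSW] Thm. 3.7 for the belt
twists.**  If `s₋(τ^ε ∘ K) = s ↔ s₋(K) = s` for all core-missing null-homologous model knots `K`
and all `ε ∈ ℤʳ` (hypothesis `h37`: [MMSW] Thm. 3.7 for `φ = Π_j σ_j^{ε_j}`), then, given the
diagonal finite approximation theorem (`MMSW.eventually_approxHasRasmussen`, Thm. 1.4),
well-definedness (`MMSW.hasSMinus_unique`, Thm. 1.3) and Reidemeister's theorem (uniqueness of `s`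
in `S³`), the Rasmussen invariants of `D(k⃗)(τ^ε ∘ K)` and `D(k⃗)(K)` agree for all large `k`: both
sequences are eventually constant, with values `s₋(τ^ε ∘ K)` and `s₋(K)`, which `h37` identifies.
[cite: ManolescuMarengonSarkarWillis2023, Thm. 3.7, Thm. 3.3 and Thm. 3.4] -/
theorem eventually_approxHasRasmussen_multiIndex_of_hasSMinus_beltTwist_comp_iff
    (h37 : ∀ {r : ℕ} {K : 𝕊 1 → 𝔼 4} (ε : Fin r → ℤ) (s : ℤ), IsModelKnot r K →
      IsNullHomologous r K → (∀ t, wC (K t) ≠ 0) →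
        (HasSMinus r (beltTwist r ε ∘ K) s ↔ HasSMinus r K s))
    (hev : eventually_approxHasRasmussen) (huniq : hasSMinus_unique) (hR : Knot.reidemeister) :
    eventually_approxHasRasmussen_multiIndex := by
  rw [eventually_approxHasRasmussen_multiIndex_iff]
  intro r K hK h0 hw ε
  have hK' : IsModelKnot r (beltTwist r ε ∘ K) := hK.beltTwist_comp ε
  have h0' : IsNullHomologous r (beltTwist r ε ∘ K) :=
    (isNullHomologous_beltTwist_comp_iff K ε).2 h0
  have hw' : ∀ t, wC ((beltTwist r ε ∘ K) t) ≠ 0 := wC_beltTwist_comp_ne_zero hK hw ε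
  obtain ⟨s₀, k₀, hk⟩ := hev hK h0 hw
  obtain ⟨s₁, k₁, hk'⟩ := hev hK' h0' hw'
  have hs₀ : HasSMinus r K s₀ := ⟨h0, K, IsModelIsotopic.refl hK, hw, k₀, hk⟩
  have hs₁ : HasSMinus r (beltTwist r ε ∘ K) s₁ :=
    ⟨h0', beltTwist r ε ∘ K, IsModelIsotopic.refl hK', hw', k₁, hk'⟩
  obtain rfl : s₁ = s₀ := huniq ((h37 ε s₁ hK h0 hw).1 hs₁) hs₀
  refine ⟨max k₀ k₁, fun k hkk s ↦ ?_⟩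
  have h1 : ApproxHasRasmussen r k (beltTwist r ε ∘ K) s₁ := hk' k ((le_max_right _ _).trans hkk)
  have h2 : ApproxHasRasmussen r k K s₁ := hk k ((le_max_left _ _).trans hkk)
  exact ⟨fun h ↦ by rw [h.unique hR h1]; exact h2, fun h ↦ by rw [h.unique hR h2]; exact h1⟩

/-- **Conversely, the fact gives [MMSW] Thm. 3.7 for the belt twists**, for every model knot:
a representative `K''` of `K` (isotopic, core-missing, with eventually constant `s(D(k⃗)(K''))`)
gives the representative `τ^ε ∘ K''` of `τ^ε ∘ K` (`τ^ε` transports model isotopies), whose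
finite approximations have eventually the same Rasmussen invariants by the fact; the converse
implication is the same for `τ^{-ε}`. [cite: ManolescuMarengonSarkarWillis2023, Thm. 3.7] -/
theorem hasSMinus_beltTwist_comp_iff_of_multiIndex (hm : eventually_approxHasRasmussen_multiIndex)
    {K : 𝕊 1 → 𝔼 4} (hK : IsModelKnot r K) (ε : Fin r → ℤ) (s : ℤ) :
    HasSMinus r (beltTwist r ε ∘ K) s ↔ HasSMinus r K s := by
  rw [eventually_approxHasRasmussen_multiIndex_iff] at hm
  -- one implication, for all model knots and all multi-indices, suffices
  suffices key : ∀ {K : 𝕊 1 → 𝔼 4} (ε : Fin r → ℤ), IsModelKnot r K → HasSMinus r K s →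
      HasSMinus r (beltTwist r ε ∘ K) s by
    refine ⟨fun h ↦ ?_, key ε hK⟩
    have h' := key (-ε) (hK.beltTwist_comp ε) h
    rwa [beltTwist_neg_comp_beltTwist_comp hK.mem] at h'
  intro K ε hK h
  obtain ⟨h0, K'', hiso, hw'', k₀, hk⟩ := h
  have hK'' : IsModelKnot r K'' := hiso.isModelKnot_right
  obtain ⟨k₁, hk₁⟩ := hm hK'' (hiso.isNullHomologous h0) hw'' ε
  refine ⟨(isNullHomologous_beltTwist_comp_iff K ε).2 h0, beltTwist r ε ∘ K'', hiso.beltTwist_comp ε,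
    wC_beltTwist_comp_ne_zero hK'' hw'' ε, max k₀ k₁, fun k hkk ↦ ?_⟩
  exact (hk₁ k ((le_max_right _ _).trans hkk) s).2 (hk k ((le_max_left _ _).trans hkk))

/-- **[MMSW] Thm. 3.7 for all belt twists `τ^ε` from the `r` generators `σ_j = τ^{e_j}`**: the set
of multi-indices `ε` with `s₋(τ^ε ∘ K) = s ↔ s₋(K) = s` for all model knots `K` contains `0`, is
closed under addition (`τ^{ε + ε'} = τ^{ε'} ∘ τ^ε` on `M_r`) and under negation (`τ^{-ε}` is the
inverse), so it is all of `ℤʳ` as soon as it contains the basis vectors.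
[cite: ManolescuMarengonSarkarWillis2023, §2.3 and Thm. 3.7] -/
theorem hasSMinus_beltTwist_comp_iff_of_single
    (h1 : ∀ {K : 𝕊 1 → 𝔼 4} (j : Fin r) (s : ℤ), IsModelKnot r K →
      (HasSMinus r (beltTwist r (Pi.single j 1) ∘ K) s ↔ HasSMinus r K s))
    {K : 𝕊 1 → 𝔼 4} (hK : IsModelKnot r K) (ε : Fin r → ℤ) (s : ℤ) :
    HasSMinus r (beltTwist r ε ∘ K) s ↔ HasSMinus r K s := by
  -- the good multi-indices: `0`, closed under `+` and `-`, containing the `e_j`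
  have hP0 : ∀ K : 𝕊 1 → 𝔼 4, IsModelKnot r K →
      (HasSMinus r (beltTwist r 0 ∘ K) s ↔ HasSMinus r K s) := fun K _ ↦ by
    rw [show beltTwist r 0 ∘ K = K from funext fun t ↦ beltTwist_zero (K t)]
  have hPadd : ∀ ε ε' : Fin r → ℤ,
      (∀ K : 𝕊 1 → 𝔼 4, IsModelKnot r K → (HasSMinus r (beltTwist r ε ∘ K) s ↔ HasSMinus r K s)) →
      (∀ K : 𝕊 1 → 𝔼 4, IsModelKnot r K → (HasSMinus r (beltTwist r ε' ∘ K) s ↔ HasSMinus r K s)) →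
      ∀ K : 𝕊 1 → 𝔼 4, IsModelKnot r K →
        (HasSMinus r (beltTwist r (ε + ε') ∘ K) s ↔ HasSMinus r K s) :=
    fun ε ε' hε hε' K hK ↦ by
      rw [← beltTwist_comp_beltTwist_comp hK.mem ε ε', hε' _ (hK.beltTwist_comp ε), hε K hK]
  have hPneg : ∀ ε : Fin r → ℤ,
      (∀ K : 𝕊 1 → 𝔼 4, IsModelKnot r K → (HasSMinus r (beltTwist r ε ∘ K) s ↔ HasSMinus r K s)) →
      ∀ K : 𝕊 1 → 𝔼 4, IsModelKnot r K →
        (HasSMinus r (beltTwist r (-ε) ∘ K) s ↔ HasSMinus r K s) := fun ε hε K hK ↦ by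
    have h := hε _ (hK.beltTwist_comp (-ε))
    rw [beltTwist_comp_beltTwist_comp hK.mem, neg_add_cancel,
      show beltTwist r 0 ∘ K = K from funext fun t ↦ beltTwist_zero (K t)] at h
    exact h.symm
  have hPsingle : ∀ (j : Fin r) (m : ℤ), ∀ K : 𝕊 1 → 𝔼 4, IsModelKnot r K →
      (HasSMinus r (beltTwist r (Pi.single j m) ∘ K) s ↔ HasSMinus r K s) := fun j m ↦ by
    induction m using Int.induction_on with
    | zero => rw [Pi.single_zero]; exact hP0
    | succ n ih => rw [Pi.single_add]; exact hPadd _ _ ih fun K hK ↦ h1 j s hK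
    | pred n ih =>
      rw [sub_eq_add_neg, Pi.single_add]
      refine hPadd _ _ ih ?_
      rw [Pi.single_neg]
      exact hPneg _ fun K hK ↦ h1 j s hK
  exact Pi.single_induction (fun ε ↦ ∀ K : 𝕊 1 → 𝔼 4, IsModelKnot r K →
    (HasSMinus r (beltTwist r ε ∘ K) s ↔ HasSMinus r K s)) ε hP0 hPadd hPsingle K hK

/-- **Reduction of the fact to [MMSW] Thm. 3.7 for the `r` positive Dehn twists `σ_j`** along the
belt spheres (hypothesis `h1`: `s₋(σ_j ∘ K) = s ↔ s₋(K) = s` for model knots, `σ_j = τ^{e_j}`), over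
the diagonal facts. What `h1` asserts beyond the tree is exactly the multi-index stabilisation of
the Khovanov–Lee complexes of `D(k⃗)` in the `j`-th index ([MMSW] Cor. 2.2, Thm. 2.5, proof of
Thm. 2.8). [cite: ManolescuMarengonSarkarWillis2023, Thm. 3.7 and Thm. 2.8] -/
theorem eventually_approxHasRasmussen_multiIndex_of_hasSMinus_single_comp_iff
    (h1 : ∀ {r : ℕ} {K : 𝕊 1 → 𝔼 4} (j : Fin r) (s : ℤ), IsModelKnot r K →
      (HasSMinus r (beltTwist r (Pi.single j 1) ∘ K) s ↔ HasSMinus r K s))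
    (hev : eventually_approxHasRasmussen) (huniq : hasSMinus_unique) (hR : Knot.reidemeister) :
    eventually_approxHasRasmussen_multiIndex :=
  eventually_approxHasRasmussen_multiIndex_of_hasSMinus_beltTwist_comp_iff
    (fun ε s hK _ _ ↦ hasSMinus_beltTwist_comp_iff_of_single (fun j s hK ↦ h1 j s hK) hK ε s)
    hev huniq hR

/-! ## The diagonal fact is subordinate to the multi-index fact

`eventually_approxHasRasmussen_multiIndex` is the APEX of the pair of finite-approximation facts:
it implies the diagonal fact `MMSW.eventually_approxHasRasmussen` ([MMSW] Thm. 1.4) with no further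
input, and — over well-definedness ([MMSW] Thm. 1.3, `MMSW.hasSMinus_unique`) and Reidemeister's
theorem — it is EQUIVALENT to the conjunction of the diagonal fact and [MMSW] Thm. 3.7 for the belt
twists.  (What lies beneath both is one and the same input: the stabilisation of the Khovanov–Lee
complexes of the pictures `D(k⃗)` in EACH index separately, Willis (2021) Thm. 1.1 = [MMSW] Thm. 2.1,
Cor. 2.2, with the Lee generators preserved, [MMSW] Thm. 2.10 / Thm. 3.3 — a theory of complexes of
tangle / link diagrams under horizontal composition, whereas the tree's `GaussDiagram` /
`KhComplex` / `LeeRasmussen` stack is for single-component Gauss diagrams.) -/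

/-- **The multi-index fact implies the diagonal finite approximation theorem
`MMSW.eventually_approxHasRasmussen` ([MMSW] Thm. 1.4), with no further input.**  For the constant
multi-index `ε = (1, …, 1)` the belt twist is the sphere twist `σ`, and `D(k⃗)(σ ∘ K) = D(k⃗ + 1⃗)(K)`
(`approxHasRasmussen_beltTwist_const_comp_iff`), so the fact says that the set of Rasmussen
invariants of `D(k⃗)(K)` does not depend on `k ≥ k₀`; and that set is never empty — every finite
approximation of a core-missing model knot is a knot of `S³`, isotopic to one with a Gauss diagram
(`IsModelKnot.exists_approxHasRasmussen`, proved).  So an `s` of `D(k⃗₀)(K)` is an `s` of every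
`D(k⃗)(K)`, `k ≥ k₀` (induction on `k`). [cite: ManolescuMarengonSarkarWillis2023, Thm. 1.4 and Thm. 2.8 (proof)] -/
theorem eventually_approxHasRasmussen_of_multiIndex (hm : eventually_approxHasRasmussen_multiIndex) :
    eventually_approxHasRasmussen := by
  intro r K hK h0 hw
  rw [eventually_approxHasRasmussen_multiIndex_iff] at hm
  obtain ⟨k₀, hk⟩ := hm hK h0 hw (fun _ ↦ 1)
  obtain ⟨s, hs⟩ := hK.exists_approxHasRasmussen hw k₀
  refine ⟨s, k₀, fun k hkk ↦ ?_⟩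
  -- one more twist: `D(k⃗)(σ ∘ K) = D(k⃗ + 1⃗)(K)` has the `s` of `D(k⃗)(K)` for `k ≥ k₀`
  have step : ∀ k : ℤ, k₀ ≤ k → ApproxHasRasmussen r k K s → ApproxHasRasmussen r (k + 1) K s :=
    fun k hk0 h ↦ by
      have h' := (hk k hk0 s).2 h
      rw [approxHasRasmussen_beltTwist_const_comp_iff hK.mem 1 k s, add_comm] at h'
      exact h'
  exact Int.leInduction (motive := fun k _ ↦ ApproxHasRasmussen r k K s) hs
    (fun k hk0 ih ↦ step k hk0 ih) k hkk

/-- **The multi-index fact is exactly "[MMSW] Thm. 1.4 and Thm. 3.7 for the belt twists"**, over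
well-definedness of `s₋` ([MMSW] Thm. 1.3, the fact `MMSW.hasSMinus_unique`) and Reidemeister's
theorem (uniqueness of `s` of a knot in `S³`): `→` is `eventually_approxHasRasmussen_of_multiIndex`
and `hasSMinus_beltTwist_comp_iff_of_multiIndex` (both unconditional), `←` is
`eventually_approxHasRasmussen_multiIndex_of_hasSMinus_beltTwist_comp_iff`.
[cite: ManolescuMarengonSarkarWillis2023, Thm. 1.4, Thm. 3.3 and Thm. 3.7] -/
theorem eventually_approxHasRasmussen_multiIndex_iff_and_hasSMinus_beltTwist_comp_iff
    (huniq : hasSMinus_unique) (hR : Knot.reidemeister) :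
    eventually_approxHasRasmussen_multiIndex ↔
      eventually_approxHasRasmussen ∧
        ∀ {r : ℕ} {K : 𝕊 1 → 𝔼 4} (ε : Fin r → ℤ) (s : ℤ), IsModelKnot r K →
          (HasSMinus r (beltTwist r ε ∘ K) s ↔ HasSMinus r K s) :=
  ⟨fun hm ↦ ⟨eventually_approxHasRasmussen_of_multiIndex hm,
      fun ε s hK ↦ hasSMinus_beltTwist_comp_iff_of_multiIndex hm hK ε s⟩,
    fun h ↦ eventually_approxHasRasmussen_multiIndex_of_hasSMinus_beltTwist_comp_iff
      (fun ε s hK _ _ ↦ h.2 ε s hK) h.1 huniq hR⟩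

end MMSW

end Literature.Topology.FourManifolds

end
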